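import Mathlib
import HarnessLib
import Summits.NavierStokesRegularity.NavierStokesRegularity.Theses.LevelSetModeration
import Literature.Analysis.FluidPDE.ConstantinDirectionDissipationProofs
import Literature.Analysis.FluidPDE.TaoEnstrophyLocalisationProofs

/-!
# Consequences of `HighSpeedPressureWork` (route LevelSetModeration, crux 2)

Helper lemmas for the crux item stmt-NavierStokesRegularity-18149
(`Summit.NavierStokesRegularity.NavierStokesRegularity.Theses.LevelSetModeration`, decl
`HighSpeedPressureWork`)
and for the first step of crux 3 (`LevelSetClosure`, stmt-NavierStokesRegularity-18150).

* finiteness of the level-set quantities of the route: for a classical Leray–Hopf solution the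
  level-set speed dissipation `D_c(T) = ∫₀ᵀ∫ 1_{|u|>c} |∇|u||²` is finite and `ν D_c(T) ≤ ½‖u₀‖₂²`
  (`|∇|u|| ≤ ‖∇u‖_op ≤ |∇u|_F` where `|u| > c ≥ 0`, uniqueness of weak gradients);
* the SQUARING STEP of the De Giorgi scheme: if the pressure work `PW_c(t)` dominates
  `ν D_c(t)` for all `t < T` (the level-set energy inequality) and is bounded by
  `√(Λ M^m V_c(T)) · √(D_c(T))` (the crux bound), then `ν √(D_c(T)) ≤ √(Λ M^m V_c(T))`
  (continuity from below of the time integral, `setLIntegral_iUnion_of_directed`), whence the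
  pressure-free SPEED-GRADIENT LAW `ν² D_c(T) ≤ Λ M^m V_c(T)` and the De Giorgi input
  `∫(|u(t)|−c)₊² + 2ν D_c(T) ≤ 4 Λ M^m V_c(T) / ν`;
* packaged forms: `HighSpeedPressureWork → LevelSetEnergyInequality → speed-gradient law` and the
  single-solution form consumed by `LevelSetClosure`.

No new definitions; the route's expressions are written out verbatim.
-/

-- single-conjunct summit: `Summit.<Summit>.<Problem>` repeats the name by the D-0017 layout
set_option linter.dupNamespace false

namespace Summit.NavierStokesRegularity.NavierStokesRegularity.Theorems

open MeasureTheory Set Filter Topology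
open scoped ENNReal
open Literature.Analysis.FluidPDE
open Summit.NavierStokesRegularity.NavierStokesRegularity.Theses.LevelSetModeration

/-! ### Pointwise: the speed gradient is dominated by the velocity gradient -/

/-- `‖∇|u|(x)‖ ≤ ‖∇u(x)‖_op` at a point where `u` is differentiable and `u x ≠ 0` (chain rule and
`‖D‖·‖(y)‖ ≤ 1`, Mathlib `norm_fderiv_le_of_lipschitz`). [folklore] -/
theorem norm_fderiv_norm_comp_le {u : EuclideanSpace ℝ (Fin 3) → EuclideanSpace ℝ (Fin 3)}
    {x : EuclideanSpace ℝ (Fin 3)} (hu : DifferentiableAt ℝ u x)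
    (hx : u x ≠ 0) : ‖fderiv ℝ (fun y => ‖u y‖) x‖ ≤ ‖fderiv ℝ u x‖ := by
  have hn : DifferentiableAt ℝ (‖·‖) (u x) :=
    (contDiffAt_norm (n := 1) ℝ hx).differentiableAt one_ne_zero
  have hcomp : fderiv ℝ (fun y => ‖u y‖) x = (fderiv ℝ (‖·‖) (u x)).comp (fderiv ℝ u x) :=
    fderiv_comp x hn hu
  have h1 : ‖fderiv ℝ (‖·‖) (u x)‖ ≤ 1 := by
    have := norm_fderiv_le_of_lipschitz ℝ (lipschitzWith_one_norm (E := EuclideanSpace ℝ (Fin 3)))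
      (x₀ := u x)
    simpa using this
  calc ‖fderiv ℝ (fun y => ‖u y‖) x‖ = ‖(fderiv ℝ (‖·‖) (u x)).comp (fderiv ℝ u x)‖ := by
        rw [hcomp]
    _ ≤ ‖fderiv ℝ (‖·‖) (u x)‖ * ‖fderiv ℝ u x‖ := ContinuousLinearMap.opNorm_comp_le _ _
    _ ≤ 1 * ‖fderiv ℝ u x‖ := by gcongr
    _ = ‖fderiv ℝ u x‖ := one_mul _

/-- On the super-level set `{|u| > c}`, `c ≥ 0`, the level-set dissipation density
`|∇|u||²` is dominated by the Frobenius density `|∇u|²_F` (pointwise, as `ℝ≥0∞` indicators).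
[folklore] -/
theorem indicator_sq_norm_fderiv_norm_le {u : EuclideanSpace ℝ (Fin 3) → EuclideanSpace ℝ (Fin 3)}
    (hu : Differentiable ℝ u) {c : ℝ}
    (hc : 0 ≤ c) (x : EuclideanSpace ℝ (Fin 3)) :
    Set.indicator {x | c < ‖u x‖} (fun x => ENNReal.ofReal (‖fderiv ℝ (fun y => ‖u y‖) x‖ ^ 2)) x
      ≤ ENNReal.ofReal (frobeniusNormSq (fderiv ℝ u x)) := by
  by_cases hx : x ∈ {x | c < ‖u x‖}
  · rw [Set.indicator_of_mem hx]
    have hx0 : u x ≠ 0 := by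
      intro h0
      have : c < ‖u x‖ := hx
      rw [h0, norm_zero] at this
      exact absurd this (not_lt.2 hc)
    refine ENNReal.ofReal_le_ofReal ?_
    calc ‖fderiv ℝ (fun y => ‖u y‖) x‖ ^ 2 ≤ ‖fderiv ℝ u x‖ ^ 2 := by
          gcongr
          exact norm_fderiv_norm_comp_le (hu x) hx0
      _ ≤ frobeniusNormSq (fderiv ℝ u x) := sq_opNorm_le_frobeniusNormSq _
  · rw [Set.indicator_of_notMem hx]
    exact bot_le

/-! ### The level-set dissipation of a classical Leray–Hopf solution is finite -/

/-- For a classical solution on `[0,T)` and a level `c ≥ 0`, the level-set speed dissipation is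
dominated by the full dissipation through the classical gradient:
`∫₀^{T'}∫ 1_{|u|>c} |∇|u||² ≤ ∫₀^{T'}∫ |∇u|²_F` for every `T' ≤ T` (slices are `C^∞`, so
`indicator_sq_norm_fderiv_norm_le` applies for every `τ ∈ (0,T')`). [folklore] -/
theorem levelSetDissipation_le_lintegral_frobenius {ν T : ℝ}
    {u : ℝ → EuclideanSpace ℝ (Fin 3) → EuclideanSpace ℝ (Fin 3)}
    {p : ℝ → EuclideanSpace ℝ (Fin 3) → ℝ}
    (hcl : IsClassicalNSSolutionOn (Ico 0 T) ν 0 u p) {c : ℝ} (hc : 0 ≤ c) {T' : ℝ}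
    (hT' : T' ≤ T) :
    (∫⁻ τ in Ioo 0 T', ∫⁻ x, Set.indicator {x | c < ‖u τ x‖}
        (fun x => ENNReal.ofReal (‖fderiv ℝ (fun y => ‖u τ y‖) x‖ ^ 2)) x)
      ≤ ∫⁻ τ in Ioo 0 T', ∫⁻ x, ENNReal.ofReal (frobeniusNormSq (fderiv ℝ (u τ) x)) := by
  refine lintegral_mono_ae ?_
  filter_upwards [ae_restrict_mem measurableSet_Ioo] with τ hτ
  have hτ' : τ ∈ Ico 0 T := ⟨hτ.1.le, hτ.2.trans_le hT'⟩
  have hdiff : Differentiable ℝ (u τ) :=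
    (hcl.contDiff_velocity hτ').differentiable (by simp)
  exact lintegral_mono fun x => indicator_sq_norm_fderiv_norm_le hdiff hc x

/-- **Finiteness of the level-set dissipation.** For a classical solution on `[0,T)`, `T > 0`,
which is Leray–Hopf on `[0,T]`, and a level `c ≥ 0`: `D_c(T) = ∫₀ᵀ∫ 1_{|u|>c}|∇|u||² < ∞`, and
for `ν ≥ 0` the energy inequality gives `ν D_c(T) ≤ ½‖u(0)‖₂²` (the weak gradient of the
Leray–Hopf inequality is the classical one a.e.,
`IsLerayHopfOn.lintegral_frobeniusNormSq_fderiv_of_classical`). In particular the factor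
`(D_c(T)).toReal` of the route's statements is never the junk value of an infinite integral.
[folklore] -/
theorem levelSetDissipation_ne_top {ν T : ℝ}
    {u : ℝ → EuclideanSpace ℝ (Fin 3) → EuclideanSpace ℝ (Fin 3)}
    {p : ℝ → EuclideanSpace ℝ (Fin 3) → ℝ}
    (hcl : IsClassicalNSSolutionOn (Ico 0 T) ν 0 u p) (hLH : IsLerayHopfOn T ν 0 (u 0) u)
    (hT : 0 < T) (hν : 0 ≤ ν) {c : ℝ} (hc : 0 ≤ c) :
    (∫⁻ τ in Ioo 0 T, ∫⁻ x, Set.indicator {x | c < ‖u τ x‖}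
        (fun x => ENNReal.ofReal (‖fderiv ℝ (fun y => ‖u τ y‖) x‖ ^ 2)) x) ≠ ∞ ∧
    ν * (∫⁻ τ in Ioo 0 T, ∫⁻ x, Set.indicator {x | c < ‖u τ x‖}
        (fun x => ENNReal.ofReal (‖fderiv ℝ (fun y => ‖u τ y‖) x‖ ^ 2)) x).toReal ≤
      VectorCalculus.kineticEnergy (u 0) := by
  obtain ⟨hfin, hE⟩ := IsLerayHopfOn.lintegral_frobeniusNormSq_fderiv_of_classical hcl hLH hT
  have hle := levelSetDissipation_le_lintegral_frobenius hcl hc le_rfl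
  refine ⟨ne_top_of_le_ne_top hfin hle, ?_⟩
  calc ν * (∫⁻ τ in Ioo 0 T, ∫⁻ x, Set.indicator {x | c < ‖u τ x‖}
          (fun x => ENNReal.ofReal (‖fderiv ℝ (fun y => ‖u τ y‖) x‖ ^ 2)) x).toReal
        ≤ ν * (∫⁻ τ in Ioo 0 T, ∫⁻ x,
            ENNReal.ofReal (frobeniusNormSq (fderiv ℝ (u τ) x))).toReal :=
        mul_le_mul_of_nonneg_left (ENNReal.toReal_mono hfin hle) hν
    _ ≤ VectorCalculus.kineticEnergy (u 0) := hE

/-! ### Continuity from below of the time integral and the squaring step -/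

/-- A bound on `∫_{(0,t)} g` valid for every `t < T` passes to `t = T` (no measurability needed:
`(0,T) = ⋃ₙ (0, T − T/(n+2))` is a directed union, Mathlib `setLIntegral_iUnion_of_directed`).
[folklore] -/
theorem setLIntegral_Ioo_le_of_forall_lt {g : ℝ → ℝ≥0∞} {T : ℝ} (hT : 0 < T) {B : ℝ≥0∞}
    (h : ∀ t ∈ Ico 0 T, ∫⁻ τ in Ioo 0 t, g τ ≤ B) : ∫⁻ τ in Ioo 0 T, g τ ≤ B := by
  set s : ℕ → Set ℝ := fun n => Ioo 0 (T - T / (n + 2)) with hs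
  have hmono : Monotone s := by
    intro m n hmn
    apply Ioo_subset_Ioo le_rfl
    have : T / ((n : ℝ) + 2) ≤ T / ((m : ℝ) + 2) :=
      div_le_div_of_nonneg_left hT.le (by positivity) (by exact_mod_cast Nat.add_le_add_right hmn 2)
    linarith
  have hU : (⋃ n, s n) = Ioo 0 T := by
    ext τ
    simp only [mem_iUnion, mem_Ioo, hs]
    constructor
    · rintro ⟨n, h0, h1⟩
      exact ⟨h0, h1.trans_le (sub_le_self _ (by positivity))⟩
    · rintro ⟨h0, h1⟩
      obtain ⟨n, hn⟩ := exists_nat_gt (T / (T - τ))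
      refine ⟨n, h0, ?_⟩
      have hTτ : 0 < T - τ := sub_pos.2 h1
      have hlt : T / ((n : ℝ) + 2) < T - τ := by
        rw [div_lt_iff₀ (by positivity)]
        have h2 : T < (n : ℝ) * (T - τ) := by
          have := (div_lt_iff₀ hTτ).1 hn
          linarith
        nlinarith
      linarith
  calc ∫⁻ τ in Ioo 0 T, g τ = ∫⁻ τ in ⋃ n, s n, g τ := by rw [hU]
    _ = ⨆ n, ∫⁻ τ in s n, g τ := setLIntegral_iUnion_of_directed g hmono.directed_le
    _ ≤ B := by
        refine iSup_le fun n => h _ ⟨?_, ?_⟩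
        · have : T / ((n : ℝ) + 2) ≤ T := div_le_self hT.le (by linarith)
          linarith
        · have : 0 < T / ((n : ℝ) + 2) := by positivity
          linarith

/-- **Squaring step** (abstract form). If `ν ∫₀ᵗ g ≤ K √(∫₀ᵀ g)` for all `t < T` with
`∫₀ᵀ g < ∞` and `K ≥ 0`, then `ν √(∫₀ᵀ g) ≤ K` (continuity from below in `t`, then division by
`√(∫₀ᵀ g)` when it is positive). [folklore] -/
theorem mul_sqrt_le_of_forall_lt {g : ℝ → ℝ≥0∞} {ν T K : ℝ} (hν : 0 < ν) (hT : 0 < T)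
    (hfin : ∫⁻ τ in Ioo 0 T, g τ ≠ ∞) (hK : 0 ≤ K)
    (h : ∀ t ∈ Ico 0 T,
      ν * (∫⁻ τ in Ioo 0 t, g τ).toReal ≤ K * Real.sqrt ((∫⁻ τ in Ioo 0 T, g τ).toReal)) :
    ν * Real.sqrt ((∫⁻ τ in Ioo 0 T, g τ).toReal) ≤ K := by
  set DT := (∫⁻ τ in Ioo 0 T, g τ).toReal with hDT
  have hDT0 : 0 ≤ DT := ENNReal.toReal_nonneg
  -- step 1: the bound at `t = T`
  have h1 : ν * DT ≤ K * Real.sqrt DT := by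
    have hB : ∀ t ∈ Ico 0 T, ∫⁻ τ in Ioo 0 t, g τ ≤ ENNReal.ofReal (K * Real.sqrt DT / ν) := by
      intro t ht
      have hle : ∫⁻ τ in Ioo 0 t, g τ ≤ ∫⁻ τ in Ioo 0 T, g τ :=
        lintegral_mono_set (Ioo_subset_Ioo le_rfl ht.2.le)
      rw [← ENNReal.ofReal_toReal (ne_top_of_le_ne_top hfin hle)]
      apply ENNReal.ofReal_le_ofReal
      rw [le_div_iff₀ hν, mul_comm]
      exact h t ht
    have h2 := ENNReal.toReal_mono ENNReal.ofReal_ne_top (setLIntegral_Ioo_le_of_forall_lt hT hB)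
    rw [ENNReal.toReal_ofReal (by positivity)] at h2
    have h3 := (le_div_iff₀ hν).1 h2
    linarith [mul_comm DT ν]
  -- step 2: divide by `√DT`
  rcases hDT0.eq_or_lt with h0 | hpos
  · rw [← h0, Real.sqrt_zero, mul_zero]
    exact hK
  · have hs : 0 < Real.sqrt DT := Real.sqrt_pos.2 hpos
    have h4 : ν * Real.sqrt DT * Real.sqrt DT ≤ K * Real.sqrt DT := by
      rw [mul_assoc, Real.mul_self_sqrt hDT0]
      exact h1
    exact le_of_mul_le_mul_right h4 hs

/-- `(√A)² ≤ max A 0`. [folklore] -/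
theorem sq_sqrt_le_max (A : ℝ) : Real.sqrt A ^ 2 ≤ max A 0 := by
  rcases le_or_gt 0 A with hA | hA
  · rw [Real.sq_sqrt hA]
    exact le_max_left _ _
  · rw [Real.sqrt_eq_zero'.2 hA.le]
    simp

/-! ### The De Giorgi input from the pairing bound (single field, single level) -/

/-- **Squaring step of the level-set scheme** for one field `u`, one level `c`, `ν, T > 0`.
Write `E_c(t) = ∫ (|u(t)|−c)₊²`, `D_c(t) = ∫₀ᵗ∫ 1_{|u|>c}|∇|u||²` (the route's `toReal` of a lower
integral) and `PW_c(t) = −∫₀ᵗ∫ (1−c/|u|)₊ ∇p̃[u]·u`. Assume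
(i) the level-set energy inequality `E_c(t) + 2ν D_c(t) ≤ 2 PW_c(t)` for all `t ∈ [0,T)`
(shape of `LevelSetEnergyInequality`), (ii) the pressure-work bound
`PW_c(t) ≤ √A · √(D_c(T))` for all `t ∈ [0,T)` (shape of `HighSpeedPressureWork` /
`LevelSetClosure`, with `A = Λ M^m V_c(T)`), (iii) `D_c(T) < ∞`. Then
`ν √(D_c(T)) ≤ √A`, the pressure-free law `ν² D_c(T) ≤ max A 0`, and the De Giorgi input
`E_c(t) + 2ν D_c(T) ≤ 4 max A 0 / ν` for all `t ∈ [0,T)` (Vasseur 2007, proof of Prop. 3 via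
Lemma 11: the bound on `U_k` by Cauchy–Schwarz and absorption of the dissipation). [folklore] -/
theorem levelSet_bounds_of_pairing {u : ℝ → EuclideanSpace ℝ (Fin 3) → EuclideanSpace ℝ (Fin 3)}
    {c ν T A : ℝ} (hν : 0 < ν) (hT : 0 < T)
    (hfin : (∫⁻ τ in Ioo 0 T, ∫⁻ x, Set.indicator {x | c < ‖u τ x‖}
        (fun x => ENNReal.ofReal (‖fderiv ℝ (fun y => ‖u τ y‖) x‖ ^ 2)) x) ≠ ∞)
    (hLSEI : ∀ t ∈ Ico 0 T, (∫ x, (max (‖u t x‖ - c) 0) ^ 2) + 2 * ν *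
        (∫⁻ τ in Ioo 0 t, ∫⁻ x, Set.indicator {x | c < ‖u τ x‖}
          (fun x => ENNReal.ofReal (‖fderiv ℝ (fun y => ‖u τ y‖) x‖ ^ 2)) x).toReal ≤
        -(2 * ∫ τ in Ioo 0 t, ∫ x, max (1 - c / ‖u τ x‖) 0 *
          (fderiv ℝ (normalisedPressure (u τ)) x (u τ x))))
    (hPW : ∀ t ∈ Ico 0 T, -(∫ τ in Ioo 0 t, ∫ x, max (1 - c / ‖u τ x‖) 0 *
          (fderiv ℝ (normalisedPressure (u τ)) x (u τ x))) ≤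
        Real.sqrt A * Real.sqrt ((∫⁻ τ in Ioo 0 T, ∫⁻ x, Set.indicator {x | c < ‖u τ x‖}
          (fun x => ENNReal.ofReal (‖fderiv ℝ (fun y => ‖u τ y‖) x‖ ^ 2)) x).toReal)) :
    ν * Real.sqrt ((∫⁻ τ in Ioo 0 T, ∫⁻ x, Set.indicator {x | c < ‖u τ x‖}
          (fun x => ENNReal.ofReal (‖fderiv ℝ (fun y => ‖u τ y‖) x‖ ^ 2)) x).toReal)
        ≤ Real.sqrt A ∧
    ν ^ 2 * (∫⁻ τ in Ioo 0 T, ∫⁻ x, Set.indicator {x | c < ‖u τ x‖}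
          (fun x => ENNReal.ofReal (‖fderiv ℝ (fun y => ‖u τ y‖) x‖ ^ 2)) x).toReal
        ≤ max A 0 ∧
    ∀ t ∈ Ico 0 T, (∫ x, (max (‖u t x‖ - c) 0) ^ 2) + 2 * ν *
        (∫⁻ τ in Ioo 0 T, ∫⁻ x, Set.indicator {x | c < ‖u τ x‖}
          (fun x => ENNReal.ofReal (‖fderiv ℝ (fun y => ‖u τ y‖) x‖ ^ 2)) x).toReal
        ≤ 4 * max A 0 / ν := by
  set g : ℝ → ℝ≥0∞ := fun τ => ∫⁻ x, Set.indicator {x | c < ‖u τ x‖}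
      (fun x => ENNReal.ofReal (‖fderiv ℝ (fun y => ‖u τ y‖) x‖ ^ 2)) x with hg
  set DT := (∫⁻ τ in Ioo 0 T, g τ).toReal with hDT
  have hDT0 : 0 ≤ DT := ENNReal.toReal_nonneg
  have hK : 0 ≤ Real.sqrt A := Real.sqrt_nonneg _
  have hE0 : ∀ t, 0 ≤ ∫ x, (max (‖u t x‖ - c) 0) ^ 2 := fun t =>
    integral_nonneg fun x => sq_nonneg _
  -- `ν D_c(t) ≤ √A √D_T` for all `t < T`
  have hD : ∀ t ∈ Ico 0 T, ν * (∫⁻ τ in Ioo 0 t, g τ).toReal ≤ Real.sqrt A * Real.sqrt DT := by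
    intro t ht
    have h1 := hLSEI t ht
    have h2 := hPW t ht
    have h3 := hE0 t
    have hDt0 : 0 ≤ (∫⁻ τ in Ioo 0 t, g τ).toReal := ENNReal.toReal_nonneg
    nlinarith
  have hmain : ν * Real.sqrt DT ≤ Real.sqrt A := mul_sqrt_le_of_forall_lt hν hT hfin hK hD
  have hsqrt : Real.sqrt DT ≤ Real.sqrt A / ν := by
    rw [le_div_iff₀ hν, mul_comm]; exact hmain
  refine ⟨hmain, ?_, ?_⟩
  · -- square
    have h0 : 0 ≤ ν * Real.sqrt DT := by positivity
    calc ν ^ 2 * DT = (ν * Real.sqrt DT) ^ 2 := by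
          rw [mul_pow, Real.sq_sqrt hDT0]
      _ ≤ Real.sqrt A ^ 2 := pow_le_pow_left₀ h0 hmain 2
      _ ≤ max A 0 := sq_sqrt_le_max A
  · intro t ht
    have h1 := hLSEI t ht
    have h2 := hPW t ht
    have hDt0 : 0 ≤ (∫⁻ τ in Ioo 0 t, g τ).toReal := ENNReal.toReal_nonneg
    -- `E_c(t) ≤ 2 √A √D_T`, `2 ν D_T ≤ 2 √A √D_T`, `√D_T ≤ √A / ν`
    have h4 : (∫ x, (max (‖u t x‖ - c) 0) ^ 2) ≤ 2 * (Real.sqrt A * Real.sqrt DT) := by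
      nlinarith
    have h5 : 2 * ν * DT ≤ 2 * (Real.sqrt A * Real.sqrt DT) := by
      have : ν * DT = (ν * Real.sqrt DT) * Real.sqrt DT := by
        rw [mul_assoc, Real.mul_self_sqrt hDT0]
      nlinarith [Real.sqrt_nonneg DT]
    have h6 : Real.sqrt A * Real.sqrt DT ≤ Real.sqrt A * (Real.sqrt A / ν) :=
      mul_le_mul_of_nonneg_left hsqrt hK
    have h7 : Real.sqrt A * (Real.sqrt A / ν) = Real.sqrt A ^ 2 / ν := by ring
    have h8 : Real.sqrt A ^ 2 / ν ≤ max A 0 / ν :=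
      div_le_div_of_nonneg_right (sq_sqrt_le_max A) hν.le
    calc (∫ x, (max (‖u t x‖ - c) 0) ^ 2) + 2 * ν * DT
          ≤ 4 * (Real.sqrt A * Real.sqrt DT) := by linarith
      _ ≤ 4 * (max A 0 / ν) := by nlinarith
      _ = 4 * max A 0 / ν := by ring

/-! ### Packaged forms for the route -/

/-- **De Giorgi input for `LevelSetClosure` (crux 3, stmt-NavierStokesRegularity-18150).**
Under the hypotheses of `LevelSetClosure` — a classical Leray–Hopf solution from a rapidly
decaying datum with `|u₀| ≤ M₀/2` obeying the pressure-work bound with modulus `Λ` and exponent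
`m` for all `M ≥ M₀`, `c ∈ [M/2, M]` — and GIVEN the level-set energy inequality of the route
(`LevelSetEnergyInequality`, stmt-NavierStokesRegularity-18151, taken as a hypothesis), every
admissible level `c` satisfies `ν √D_c(T) ≤ √(Λ M^m V_c(T))`, the pressure-free law
`ν² D_c(T) ≤ max(Λ M^m V_c(T), 0)` and
`U(c) : ∫(|u(t)|−c)₊² + 2ν D_c(T) ≤ 4 max(Λ M^m V_c(T), 0)/ν` for all `t ∈ [0,T)` — the
starting estimate "U_k ≤ 4ΛM^m|A_{c_k}|/ν" of the De Giorgi iteration for the speed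
(Vasseur 2007, §4). [folklore] -/
theorem levelSetEnergy_le_of_pairingBound (hL : LevelSetEnergyInequality) {ν T : ℝ}
    (hν : 0 < ν) (hT : 0 < T) {u : ℝ → EuclideanSpace ℝ (Fin 3) → EuclideanSpace ℝ (Fin 3)}
    {p : ℝ → EuclideanSpace ℝ (Fin 3) → ℝ}
    (hcl : IsClassicalNSSolutionOn (Ico 0 T) ν 0 u p) (hLH : IsLerayHopfOn T ν 0 (u 0) u)
    (hdec : HasRapidSpatialDecay (u 0)) {m Λ M₀ : ℝ} (hu0 : ∀ x, ‖u 0 x‖ ≤ M₀ / 2)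
    (hPW : ∀ (M c t : ℝ), M₀ ≤ M → M / 2 ≤ c → c ≤ M → 0 < c → t ∈ Ico 0 T →
      -(∫ τ in Ioo 0 t, ∫ x, max (1 - c / ‖u τ x‖) 0 *
          (fderiv ℝ (normalisedPressure (u τ)) x (u τ x))) ≤
        Real.sqrt (Λ * M ^ m * (∫⁻ τ in Ioo 0 T, volume {x | c < ‖u τ x‖}).toReal) *
        Real.sqrt ((∫⁻ τ in Ioo 0 T, ∫⁻ x, Set.indicator {x | c < ‖u τ x‖}
          (fun x => ENNReal.ofReal (‖fderiv ℝ (fun y => ‖u τ y‖) x‖ ^ 2)) x).toReal))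
    {M c : ℝ} (hM : M₀ ≤ M) (hMc : M / 2 ≤ c) (hcM : c ≤ M) (hc : 0 < c) :
    ν * Real.sqrt ((∫⁻ τ in Ioo 0 T, ∫⁻ x, Set.indicator {x | c < ‖u τ x‖}
          (fun x => ENNReal.ofReal (‖fderiv ℝ (fun y => ‖u τ y‖) x‖ ^ 2)) x).toReal)
        ≤ Real.sqrt (Λ * M ^ m * (∫⁻ τ in Ioo 0 T, volume {x | c < ‖u τ x‖}).toReal) ∧
    ν ^ 2 * (∫⁻ τ in Ioo 0 T, ∫⁻ x, Set.indicator {x | c < ‖u τ x‖}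
          (fun x => ENNReal.ofReal (‖fderiv ℝ (fun y => ‖u τ y‖) x‖ ^ 2)) x).toReal
        ≤ max (Λ * M ^ m * (∫⁻ τ in Ioo 0 T, volume {x | c < ‖u τ x‖}).toReal) 0 ∧
    ∀ t ∈ Ico 0 T, (∫ x, (max (‖u t x‖ - c) 0) ^ 2) + 2 * ν *
        (∫⁻ τ in Ioo 0 T, ∫⁻ x, Set.indicator {x | c < ‖u τ x‖}
          (fun x => ENNReal.ofReal (‖fderiv ℝ (fun y => ‖u τ y‖) x‖ ^ 2)) x).toReal
        ≤ 4 * max (Λ * M ^ m * (∫⁻ τ in Ioo 0 T, volume {x | c < ‖u τ x‖}).toReal) 0 / ν := by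
  have hfin := (levelSetDissipation_ne_top hcl hLH hT hν.le hc.le).1
  have hu0c : ∀ x, ‖u 0 x‖ ≤ c := fun x => (hu0 x).trans (by linarith)
  have hLSEI := hL ν T hν hT u p hcl hLH hdec c hc hu0c
  exact levelSet_bounds_of_pairing hν hT hfin hLSEI (fun t ht => hPW M c t hM hMc hcM hc ht)

/-- **The pressure-free content of crux 2.** `HighSpeedPressureWork` together with the level-set
energy inequality (`LevelSetEnergyInequality`, support item of the route) implies, with the SAME
`m < 10/3` and modulus `F`, for every classical Leray–Hopf solution from a rapidly decaying datum
with `∫|u₀|² ≤ E₀`, `|u₀| ≤ B₀`, and all `M ≥ 2B₀`, `c ∈ [M/2, M]`, `c > 0`: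
the SPEED-GRADIENT LAW `ν² ∫₀ᵀ∫ 1_{|u|>c}|∇|u||² ≤ max(F(E₀,B₀) M^m ∫₀ᵀ|{|u|>c}|, 0)`
(mean-square speed gradient on the high-speed space–time set at most `F M^m/ν²`), and the
De Giorgi input `∫(|u(t)|−c)₊² + 2ν D_c(T) ≤ 4 max(F M^m V_c(T), 0)/ν`.
A refutation of the speed-gradient law by a family of classical Leray–Hopf solutions with common
`(ν, T, E₀, B₀)` therefore refutes the crux (given the certain support item), with no pressure
term to evaluate. [folklore] -/
theorem highSpeedPressureWork_speedGradientLaw (hH : HighSpeedPressureWork)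
    (hL : LevelSetEnergyInequality) :
    ∀ (ν T : ℝ), 0 < ν → 0 < T → ∃ m : ℝ, m < 10 / 3 ∧ ∃ F : ℝ → ℝ → ℝ,
      ∀ (u : ℝ → EuclideanSpace ℝ (Fin 3) → EuclideanSpace ℝ (Fin 3))
        (p : ℝ → EuclideanSpace ℝ (Fin 3) → ℝ),
        IsClassicalNSSolutionOn (Ico 0 T) ν 0 u p →
        IsLerayHopfOn T ν 0 (u 0) u → HasRapidSpatialDecay (u 0) →
        ∀ (E₀ B₀ : ℝ), (∫ x, ‖u 0 x‖ ^ 2) ≤ E₀ → (∀ x, ‖u 0 x‖ ≤ B₀) →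
        ∀ (M c : ℝ), 2 * B₀ ≤ M → M / 2 ≤ c → c ≤ M → 0 < c →
          ν ^ 2 * (∫⁻ τ in Ioo 0 T, ∫⁻ x, Set.indicator {x | c < ‖u τ x‖}
              (fun x => ENNReal.ofReal (‖fderiv ℝ (fun y => ‖u τ y‖) x‖ ^ 2)) x).toReal
            ≤ max (F E₀ B₀ * M ^ m * (∫⁻ τ in Ioo 0 T, volume {x | c < ‖u τ x‖}).toReal) 0 ∧
          ∀ t ∈ Ico 0 T, (∫ x, (max (‖u t x‖ - c) 0) ^ 2) + 2 * ν *
              (∫⁻ τ in Ioo 0 T, ∫⁻ x, Set.indicator {x | c < ‖u τ x‖}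
                (fun x => ENNReal.ofReal (‖fderiv ℝ (fun y => ‖u τ y‖) x‖ ^ 2)) x).toReal
            ≤ 4 * max (F E₀ B₀ * M ^ m * (∫⁻ τ in Ioo 0 T, volume {x | c < ‖u τ x‖}).toReal) 0
                / ν := by
  intro ν T hν hT
  obtain ⟨m, hm, F, hF⟩ := hH ν T hν hT
  refine ⟨m, hm, F, ?_⟩
  intro u p hcl hLH hdec E₀ B₀ hE hB M c hM hMc hcM hc
  have h := levelSetEnergy_le_of_pairingBound hL hν hT hcl hLH hdec (m := m) (Λ := F E₀ B₀)
    (M₀ := 2 * B₀) (fun x => by linarith [hB x])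
    (fun M' c' t' hM' hMc' hcM' hc' ht' => hF u p hcl hLH hdec E₀ B₀ hE hB M' c' t' hM' hMc' hcM'
      hc' ht') hM hMc hcM hc
  exact ⟨h.2.1, h.2.2⟩

end Summit.NavierStokesRegularity.NavierStokesRegularity.Theorems
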